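import Mathlib
import HarnessLib
import Summits.NavierStokesRegularity.NavierStokesRegularity.Theorems.PoloidalWindowDoorPoloidalWindowRigidityTimeHeightShearPressure
import Summits.NavierStokesRegularity.NavierStokesRegularity.Theorems.PoloidalWindowDoorPoloidalWindowRigiditySlopeFunctionPressure
import Summits.NavierStokesRegularity.NavierStokesRegularity.Theorems.PoloidalWindowDoorPoloidalWindowRigidityConstantShearSlice

/-!
# Route `PoloidalWindowDoor`, crux `PoloidalWindowRigidity` (K2, stmt-NavierStokesRegularity-19708) — line «lrc-jet» v4,
# stub `stub_timeHeightShear`, STEP 2, first identity: the WEIGHTED CLEBSCH WEIGHT `W = (1 − μ(t,x₂))·v₂` of (TH) and its source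

Cell ns-regularity-ideate, seat ns-poloidal-K2-p2 gen 4 (stub-worker under the K2 lead ns-poloidal-K2-p1 g5; file landed
`--supports stmt-NavierStokesRegularity-19708 --as helper`; brief HOME/ns-poloidal-K2-p1/BRIEF-stub_timeHeightShear.md, STEP 2;
seat note TH-STEP2.md = evidence #50 on the crux item).

On the stratum (TH) (`∂₂v_b(s,y) = μ(s,y₂) ∂_b v₂(s,y)`, `b = 0,1`, on a space–time neighbourhood) the K2 lead's pressure law
(p530500 `…TimeHeightShearPressure.timeHeightShear_pressure`) reads `(1−μ)(∂_bf)₂ = (μ_t + v₂μ_z − μ_zz)∂_bv₂ − 2μ_z∂₂∂_bv₂`.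
The brief located «the sign-free cubic source `(μ_z/2)⟨v₂′v₂²⟩`» of the variance law as the obstruction of STEP 2.  This file
records, in the kernel, the two identities behind the seat's census of that step (TH-STEP2.md):

* `material_heightWeight` — calculus along a class profile: for a weight `ρ(t, x₂)` (jointly `C²`, a function of time and
  height only), `𝓛[ρ v₂] = ρ f₂ + v₂ (ρ_t + v₂ ρ_z − ρ_zz) − 2 ρ_z ∂₂v₂` at every point (`𝓛 = ∂ₜ + v·∇ − Δ`, `f₂ = 𝓛v₂`
  the vertical component of the intrinsic residual `= −∂₂p`).
* `horizFDeriv_weightSource_eq_zero` — **THE SOURCE OF `W := (1−μ)v₂` IS `A(t,x₂) − (μ_z/2)v₂²`**: on (TH) the scalar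
  `𝒜 := (1−μ)f₂ − (μ_t − μ_zz)v₂ − (μ_z/2)v₂² + 2μ_z∂₂v₂` has vanishing horizontal derivatives (the pressure law + the
  symmetry `∂_b∂₂v₂ = ∂₂∂_bv₂`), and by `material_heightWeight` with `ρ = 1 − μ`,
  `𝓛W = 𝒜 − (μ_z/2)v₂²` (`material_W_eq`).  So the weight of (TH) is driven by a HEIGHT-ONLY source plus the quadratic
  self-interaction `−(μ_z/2)v₂²` — in (TV) (`μ_z = 0`) the latter is absent and `W` feeds nsreg-p7's decaying-slope
  Liouville lemma once `𝒜` is flat (K2-p2 g3, p525351); on (TH) it is the term no ancient Liouville lemma of the tree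
  handles (critical size `O(1/(−t))` relative to `W`, no sign), while in the horizontal-variance law it is exactly
  removable by the weight `(1−μ)` (the cubic central moment cancels, TH-STEP2 §2) at the price of the critical rate
  `−(∂ₜ + ⟨v₂⟩∂_z)log(1−μ)` — the located obstruction of the stub, sharper than the brief's.

WHAT THIS IS NOT: not a claim about Navier–Stokes regularity and not the stub — two identities of the stratum (TH)
(bears_on LADDER-NS N0 via crux K2 = stmt-19708).
-/

noncomputable section

-- the summit and its single sub-problem share the name (CONVENTIONS §1), as in every Theorems file
set_option linter.dupNamespace false

namespace Summit.NavierStokesRegularity.NavierStokesRegularity.Theorems.PoloidalWindowDoorPoloidalWindowRigidityTimeHeightShearWeight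

open MeasureTheory Set Function Filter Topology TopologicalSpace Metric InnerProductSpace
open scoped RealInnerProductSpace InnerProductSpace Laplacian ContDiff
open Literature.Analysis Literature.Analysis.FluidPDE
open Summit.NavierStokesRegularity.NavierStokesRegularity.Theorems.LocalSineTubeDoorProfileAlignedWindowRigidityAncient
open Summit.NavierStokesRegularity.NavierStokesRegularity.Theorems.PoloidalWindowDoorPoloidalWindowRigidityWindow
open Summit.NavierStokesRegularity.NavierStokesRegularity.Theorems.PoloidalWindowDoorPoloidalWindowRigidityFlat
open Summit.NavierStokesRegularity.NavierStokesRegularity.Theorems.PoloidalWindowDoorPoloidalWindowRigidityVelocityGradientLaw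
open Summit.NavierStokesRegularity.NavierStokesRegularity.Theorems.PoloidalWindowDoorPoloidalWindowRigidityMaterialLeibniz
open Summit.NavierStokesRegularity.NavierStokesRegularity.Theorems.PoloidalWindowDoorPoloidalWindowRigidityConstantShearMeans
open Summit.NavierStokesRegularity.NavierStokesRegularity.Theorems.PoloidalWindowDoorPoloidalWindowRigidityConstantShearSlice
open Summit.NavierStokesRegularity.NavierStokesRegularity.Theorems.PoloidalWindowDoorPoloidalWindowRigidityTimeHeightShearPressure
open Summit.NavierStokesRegularity.NavierStokesRegularity.Theorems.PoloidalWindowDoorPoloidalWindowRigiditySlopeFunctionPressure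

variable {C : ℝ} {v : ℝ → EuclideanSpace ℝ (Fin 3) → EuclideanSpace ℝ (Fin 3)}

/-- The time slice `τ ↦ G τ s` of a jointly differentiable `G : ℝ → ℝ → ℝ` has derivative `DG(τ,s)(1,0)`
(the second half of `…SlopeFunctionSource.hasDerivAt_slices_of_uncurry`, restated here so that this file does not wait
for that module's farm build). -/
theorem hasDerivAt_timeSlice_of_uncurry {G : ℝ → ℝ → ℝ} {τ s : ℝ} (hG : DifferentiableAt ℝ (uncurry G) (τ, s)) :
    HasDerivAt (fun τ' => G τ' s) (fderiv ℝ (uncurry G) (τ, s) (1, 0)) τ := by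
  have h := (hG.hasFDerivAt.comp τ (hasFDerivAt_prodMk_left τ s)).hasDerivAt
  simp only [ContinuousLinearMap.comp_apply, ContinuousLinearMap.inl_apply] at h
  exact h

section Class

variable (hrate : HasTypeITimeDecay C v) (hcont : ContinuousOn (uncurry v) (Iio (0 : ℝ) ×ˢ univ))
  (hmild : ∀ s t : ℝ, s < t → t < 0 → ∀ x,
    v t x = UnboundedOperators.heatExtension (v s) (t - s) x - oseenDuhamel 1 s v v t x)
  (hdiv : ∀ t < 0, VectorCalculus.IsDivFree (v t))

include hrate hcont hmild hdiv

/-- **Material derivative of a height-weighted vertical velocity.**  For a profile of the class and a weight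
`ρ : ℝ → ℝ → ℝ` of `(time, height)`, jointly `C²`, at `t < 0`, `x`, with `f₂` the vertical component of the intrinsic
residual: `𝓛[ρ(·,x₂)v₂](t,x) = ρ f₂ + v₂ (∂ₜρ + v₂ ∂_zρ − ∂_z²ρ) − 2 ∂_zρ ∂₂v₂`, all weights at `(t, x₂)`. -/
theorem material_heightWeight {ρ : ℝ → ℝ → ℝ} (hρ : ContDiff ℝ 2 (uncurry ρ)) {t : ℝ} (ht : t < 0)
    (x : EuclideanSpace ℝ (Fin 3)) :
    deriv (fun s => ρ s (x 2) * v s x 2) t + fderiv ℝ (fun y => ρ t (y 2) * v t y 2) x (v t x)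
        - Δ (fun y => ρ t (y 2) * v t y 2) x =
      ρ t (x 2) * (timeDerivWithin (Iio 0) v t x + convect (v t) (v t) x - Δ (v t) x) 2
        + v t x 2 * (deriv (fun s => ρ s (x 2)) t + v t x 2 * deriv (ρ t) (x 2) - deriv (deriv (ρ t)) (x 2))
        - 2 * deriv (ρ t) (x 2) * fderiv ℝ (v t) x (EuclideanSpace.single 2 1) 2 := by
  have hA : IsTypeIAncientMild C v := isTypeIAncientMild_of_class hrate hcont hmild hdiv
  have hsd : Differentiable ℝ (v t) := (hA.contDiff_slice ht).differentiable (by simp)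
  have hρt2 : ContDiff ℝ 2 (ρ t) := hρ.comp (contDiff_const.prodMk contDiff_id)
  have hρd : Differentiable ℝ (ρ t) := hρt2.differentiable (by norm_num)
  -- the two factors as space–time scalars
  have h1t : DifferentiableAt ℝ (fun s => ρ s (x 2)) t := by
    have h : DifferentiableAt ℝ (uncurry ρ ∘ fun s : ℝ => (s, x 2)) t :=
      ((hρ.differentiable (by norm_num)) _).comp t (differentiableAt_id.prodMk (differentiableAt_const _))
    simpa [Function.comp_def] using h
  have h1x : ContDiff ℝ 2 (fun y : EuclideanSpace ℝ (Fin 3) => ρ t (y 2)) := contDiff_comp_height hρt2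
  have h2t : DifferentiableAt ℝ (fun s => v s x 2) t := differentiableAt_vert_time hrate hcont hmild hdiv ht x
  have h2x : ContDiff ℝ 2 (fun y => v t y 2) := (contDiff_vert_slice hrate hcont hmild hdiv ht).of_le (by norm_cast)
  have hL := material_mul (θ₁ := fun s y => ρ s (y 2)) (θ₂ := fun s y => v s y 2) (t := t) (x := x) (v t x)
    h1t h2t h1x h2x
  beta_reduce at hL
  rw [hL, material_vert_eq_residual hrate hcont hmild hdiv ht x, fderiv_comp_height_apply (hρd _),
    laplacian_comp_height hρt2]
  -- the gradient pairing `Σᵢ ∂ᵢρ ∂ᵢv₂ = ρ_z ∂₂v₂`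
  have hpair : ∑ i : Fin 3, fderiv ℝ (fun y : EuclideanSpace ℝ (Fin 3) => ρ t (y 2)) x (EuclideanSpace.single i 1) *
      fderiv ℝ (fun y => v t y 2) x (EuclideanSpace.single i 1) =
      deriv (ρ t) (x 2) * fderiv ℝ (v t) x (EuclideanSpace.single 2 1) 2 := by
    simp only [Fin.sum_univ_three, fderiv_comp_height_apply (hρd _), FluidPDE.fderiv_apply_coord (hsd x)]
    simp
  rw [hpair]
  ring

/-- **`𝓛W` for `W = (1 − μ)v₂`** (the case `ρ = 1 − μ` of `material_heightWeight`, rearranged):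
`𝓛W = [(1−μ)f₂ − (μ_t − μ_zz)v₂ + 2μ_z∂₂v₂] − μ_z v₂²`; the bracket MINUS `(μ_z/2)v₂²` is the horizontally constant
source `𝒜` of `horizFDeriv_weightSource_eq_zero` (stated there doubled, `2𝒜`, to stay division-free), so
`𝓛W = 𝒜 − (μ_z/2)v₂²`. -/
theorem material_W_eq {μ : ℝ → ℝ → ℝ} (hμ : ContDiff ℝ 2 (uncurry μ)) {t : ℝ} (ht : t < 0)
    (x : EuclideanSpace ℝ (Fin 3)) :
    deriv (fun s => (1 - μ s (x 2)) * v s x 2) t + fderiv ℝ (fun y => (1 - μ t (y 2)) * v t y 2) x (v t x)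
        - Δ (fun y => (1 - μ t (y 2)) * v t y 2) x =
      ((1 - μ t (x 2)) * (timeDerivWithin (Iio 0) v t x + convect (v t) (v t) x - Δ (v t) x) 2
          - (deriv (fun s => μ s (x 2)) t - deriv (deriv (μ t)) (x 2)) * v t x 2
          + 2 * deriv (μ t) (x 2) * fderiv ℝ (v t) x (EuclideanSpace.single 2 1) 2)
        - deriv (μ t) (x 2) * v t x 2 ^ 2 := by
  have hρ : ContDiff ℝ 2 (uncurry fun s z => 1 - μ s z) := contDiff_const.sub hμ
  have h := material_heightWeight hrate hcont hmild hdiv hρ ht x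
  have hμt2 : ContDiff ℝ 2 (μ t) := hμ.comp (contDiff_const.prodMk contDiff_id)
  have hμd : Differentiable ℝ (μ t) := hμt2.differentiable (by norm_num)
  have hμ' : ContDiff ℝ 1 (deriv (μ t)) :=
    (contDiff_succ_iff_deriv.1 (hμt2 : ContDiff ℝ ((1 : ℕ∞) + 1 : ℕ∞) (μ t))).2.2
  have hμ'd : Differentiable ℝ (deriv (μ t)) := hμ'.differentiable (by norm_num)
  -- derivatives of `1 − μ`
  have e1 : deriv (fun s => 1 - μ s (x 2)) t = -deriv (fun s => μ s (x 2)) t := by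
    have hd : DifferentiableAt ℝ (fun s => μ s (x 2)) t := by
      have h' : DifferentiableAt ℝ (uncurry μ ∘ fun s : ℝ => (s, x 2)) t :=
        ((hμ.differentiable (by norm_num)) _).comp t (differentiableAt_id.prodMk (differentiableAt_const _))
      simpa [Function.comp_def] using h'
    rw [deriv_const_sub]
  have e2 : deriv (fun z => 1 - μ t z) (x 2) = -deriv (μ t) (x 2) := by
    rw [deriv_const_sub]
  have e2f : deriv (fun z => 1 - μ t z) = fun z => -deriv (μ t) z := by
    funext z; rw [deriv_const_sub]
  have e3 : deriv (deriv fun z => 1 - μ t z) (x 2) = -deriv (deriv (μ t)) (x 2) := by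
    have e4 : (fun z => -deriv (μ t) z) = -deriv (μ t) := rfl
    rw [e2f, e4, deriv.neg]
  rw [e1, e2, e3] at h
  rw [h]
  ring

/-- **THE SOURCE OF THE WEIGHT IS HEIGHT-ONLY UP TO `−(μ_z/2)v₂²`.**  On the stratum (TH) — the proportional-shear
identities `∂₂v_b(s,y) = μ(s,y₂)∂_bv₂(s,y)` (`b = 0,1`) on a space–time neighbourhood of `(t,x)`, `μ` jointly `C³` —
the scalar `2𝒜 := 2(1−μ)f₂ − 2(μ_t − μ_zz)v₂ − μ_z v₂² + 4μ_z∂₂v₂` (doubled to stay division-free) has `∂_b(2𝒜)(t,x) = 0`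
for `b = 0,1`: the K2 lead's pressure law p530500 and the symmetry of second derivatives.  With `material_W_eq`:
`𝓛[(1−μ)v₂] = 𝒜 − (μ_z/2)v₂²` with `∇_h𝒜 = 0`. -/
theorem horizFDeriv_weightSource_eq_zero
    (hpol : ∀ s < 0, ∀ y, ⟪curl (v s) y, EuclideanSpace.single 2 1⟫_ℝ = 0) {μ : ℝ → ℝ → ℝ}
    (hμ : ContDiff ℝ 3 (uncurry μ)) {t : ℝ} (ht : t < 0) (x : EuclideanSpace ℝ (Fin 3))
    (hslope : ∀ᶠ z in 𝓝 ((t, x) : ℝ × EuclideanSpace ℝ (Fin 3)), ∀ b : Fin 3, b ≠ 2 →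
      fderiv ℝ (v z.1) z.2 (EuclideanSpace.single 2 1) b =
        μ z.1 (z.2 2) * fderiv ℝ (v z.1) z.2 (EuclideanSpace.single b 1) 2)
    {b : Fin 3} (hb : b ≠ 2) :
    fderiv ℝ (fun y =>
        2 * (1 - μ t (y 2)) * (timeDerivWithin (Iio 0) v t y + convect (v t) (v t) y - Δ (v t) y) 2
          - 2 * (deriv (fun s => μ s (y 2)) t - deriv (deriv (μ t)) (y 2)) * v t y 2
          - deriv (μ t) (y 2) * v t y 2 ^ 2
          + 4 * deriv (μ t) (y 2) * fderiv ℝ (v t) y (EuclideanSpace.single 2 1) 2) x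
      (EuclideanSpace.single b 1) = 0 := by
  have hA : IsTypeIAncientMild C v := isTypeIAncientMild_of_class hrate hcont hmild hdiv
  have hs : ContDiff ℝ ∞ (v t) := hA.contDiff_slice ht
  have hsd : Differentiable ℝ (v t) := hs.differentiable (by simp)
  have hμ2 : ContDiff ℝ 2 (uncurry μ) := hμ.of_le (by norm_cast)
  have hμt3 : ContDiff ℝ 3 (μ t) := hμ.comp (contDiff_const.prodMk contDiff_id)
  have hμt2 : ContDiff ℝ 2 (μ t) := hμt3.of_le (by norm_cast)
  have hμd : Differentiable ℝ (μ t) := hμt2.differentiable (by norm_num)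
  have hμ'2 : ContDiff ℝ 2 (deriv (μ t)) :=
    (contDiff_succ_iff_deriv.1 (hμt3 : ContDiff ℝ ((2 : ℕ∞) + 1 : ℕ∞) (μ t))).2.2
  have hμ'd : Differentiable ℝ (deriv (μ t)) := hμ'2.differentiable (by norm_num)
  have hμ''1 : ContDiff ℝ 1 (deriv (deriv (μ t))) :=
    (contDiff_succ_iff_deriv.1 (hμ'2 : ContDiff ℝ ((1 : ℕ∞) + 1 : ℕ∞) (deriv (μ t)))).2.2
  have hμ''d : Differentiable ℝ (deriv (deriv (μ t))) := hμ''1.differentiable (by norm_num)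
  -- the time partial `μ_t(t,·)` as a `C²` function of the height and its slice derivative (Clairaut)
  obtain ⟨Mt, hMt⟩ : ∃ Mt : ℝ → ℝ, ∀ z, Mt z = deriv (fun s => μ s z) t := ⟨_, fun _ => rfl⟩
  have hMt_eq : Mt = fun z => fderiv ℝ (uncurry μ) (t, z) (1, 0) := funext fun z => by
    rw [hMt]
    exact (hasDerivAt_timeSlice_of_uncurry ((hμ2.differentiable (by norm_num)) (t, z))).deriv
  have hMt2 : ContDiff ℝ 2 Mt := by
    rw [hMt_eq]
    exact ((hμ.fderiv_right (m := 2) (by norm_cast)).clm_apply contDiff_const).comp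
      (contDiff_const.prodMk contDiff_id)
  have hMtd : Differentiable ℝ Mt := hMt2.differentiable (by norm_num)
  -- the pressure law at `(t,x)`
  have hμtx : HasDerivAt (fun s => μ s (x 2)) (Mt (x 2)) t := by
    rw [hMt]
    have hd : DifferentiableAt ℝ (fun s => μ s (x 2)) t := by
      have h' : DifferentiableAt ℝ (uncurry μ ∘ fun s : ℝ => (s, x 2)) t :=
        ((hμ2.differentiable (by norm_num)) _).comp t (differentiableAt_id.prodMk (differentiableAt_const _))
      simpa [Function.comp_def] using h'
    exact hd.hasDerivAt
  have hP := (timeHeightShear_pressure hrate hcont hmild hdiv hpol ht x hslope hμt2 hμtx hb).1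
  -- ## regularity of the pieces at `x`
  have hθ : ContDiff ℝ ∞ (fun y => v t y 2) := contDiff_vert_slice hrate hcont hmild hdiv ht
  have hθd : DifferentiableAt ℝ (fun y => v t y 2) x := (hθ.differentiable (by simp)) x
  have hR : DifferentiableAt ℝ (fun y => timeDerivWithin (Iio 0) v t y + convect (v t) (v t) y - Δ (v t) y) x := by
    have h1 : ContDiff ℝ ∞ (timeDerivWithin (Iio 0) v t) := by
      rw [timeDerivWithin_Iio_eq_deriv ht]; exact contDiff_timeDeriv_slice hrate hcont hmild hdiv ht
    have h2 : ContDiff ℝ ∞ (fun y => convect (v t) (v t) y) :=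
      (hs.fderiv_right (m := ∞) (by norm_cast)).clm_apply hs
    have h3 : ContDiff ℝ 1 (Δ (v t)) := contDiff_laplacian (n := 1) (hs.of_le (by norm_cast))
    exact (((h1.differentiable (by simp)) x).add ((h2.differentiable (by simp)) x)).sub
      ((h3.differentiable (by simp)) x)
  have hF2 : DifferentiableAt ℝ
      (fun y => (timeDerivWithin (Iio 0) v t y + convect (v t) (v t) y - Δ (v t) y) 2) x :=
    ((EuclideanSpace.proj (𝕜 := ℝ) (2 : Fin 3) : EuclideanSpace ℝ (Fin 3) →L[ℝ] ℝ).differentiableAt).comp x hR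
  have hE : DifferentiableAt ℝ (fun y => fderiv ℝ (v t) y (EuclideanSpace.single 2 1) 2) x :=
    ((contDiff_fderiv_coord hrate hcont hmild hdiv ht (EuclideanSpace.single 2 1) 2).differentiable (by simp)) x
  -- height functions and their derivatives at `x`
  have hw1₀ : DifferentiableAt ℝ (fun y : EuclideanSpace ℝ (Fin 3) => 1 - μ t (y 2)) x :=
    ((contDiff_comp_height hμt2).differentiable (by norm_num) x).const_sub 1
  have hw1 : DifferentiableAt ℝ (fun y : EuclideanSpace ℝ (Fin 3) => 2 * (1 - μ t (y 2))) x := hw1₀.const_mul 2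
  have hb2 : (EuclideanSpace.single b (1 : ℝ) : EuclideanSpace ℝ (Fin 3)) 2 = 0 := by
    fin_cases b <;> simp_all
  have hw1₀' : fderiv ℝ (fun y : EuclideanSpace ℝ (Fin 3) => 1 - μ t (y 2)) x (EuclideanSpace.single b 1) = 0 := by
    have h1 := (hasFDerivAt_comp_height (hμd (x 2)).hasDerivAt).const_sub (1 : ℝ)
    rw [h1.fderiv]
    show -((deriv (μ t) (x 2) • (EuclideanSpace.proj (𝕜 := ℝ) (2 : Fin 3) :
      EuclideanSpace ℝ (Fin 3) →L[ℝ] ℝ)) (EuclideanSpace.single b 1)) = 0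
    simp only [FunLike.coe_smul, Pi.smul_apply, smul_eq_mul]
    have : (EuclideanSpace.proj (𝕜 := ℝ) (2 : Fin 3) : EuclideanSpace ℝ (Fin 3) →L[ℝ] ℝ)
        (EuclideanSpace.single b 1) = (EuclideanSpace.single b (1 : ℝ) : EuclideanSpace ℝ (Fin 3)) 2 := rfl
    rw [this, hb2, mul_zero, neg_zero]
  have hw1' : fderiv ℝ (fun y : EuclideanSpace ℝ (Fin 3) => 2 * (1 - μ t (y 2))) x (EuclideanSpace.single b 1) = 0 := by
    rw [fderiv_const_mul hw1₀]
    simp only [FunLike.coe_smul, Pi.smul_apply, smul_eq_mul, hw1₀', mul_zero]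
  have hw2₀ : DifferentiableAt ℝ (fun y : EuclideanSpace ℝ (Fin 3) => Mt (y 2) - deriv (deriv (μ t)) (y 2)) x :=
    ((contDiff_comp_height hMt2).differentiable (by norm_num) x).sub
      ((contDiff_comp_height hμ''1).differentiable (by norm_num) x)
  have hw2 : DifferentiableAt ℝ (fun y : EuclideanSpace ℝ (Fin 3) => 2 * (Mt (y 2) - deriv (deriv (μ t)) (y 2))) x :=
    hw2₀.const_mul 2
  have hw2' : fderiv ℝ (fun y : EuclideanSpace ℝ (Fin 3) => 2 * (Mt (y 2) - deriv (deriv (μ t)) (y 2))) x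
      (EuclideanSpace.single b 1) = 0 := by
    rw [fderiv_const_mul hw2₀, fderiv_fun_sub ((contDiff_comp_height hMt2).differentiable (by norm_num) x)
      ((contDiff_comp_height hμ''1).differentiable (by norm_num) x)]
    simp only [FunLike.coe_smul, Pi.smul_apply, smul_eq_mul, _root_.sub_apply]
    rw [fderiv_comp_height_apply (hMtd _), fderiv_comp_height_apply (hμ''d _), hb2]; ring
  have hw3 : DifferentiableAt ℝ (fun y : EuclideanSpace ℝ (Fin 3) => deriv (μ t) (y 2)) x :=
    (contDiff_comp_height hμ'2).differentiable (by norm_num) x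
  have hw3' : fderiv ℝ (fun y : EuclideanSpace ℝ (Fin 3) => deriv (μ t) (y 2)) x (EuclideanSpace.single b 1) = 0 := by
    rw [fderiv_comp_height_apply (hμ'd _), hb2]; ring
  have hw4 : DifferentiableAt ℝ (fun y : EuclideanSpace ℝ (Fin 3) => 4 * deriv (μ t) (y 2)) x :=
    hw3.const_mul 4
  have hw4' : fderiv ℝ (fun y : EuclideanSpace ℝ (Fin 3) => 4 * deriv (μ t) (y 2)) x (EuclideanSpace.single b 1) = 0 := by
    rw [fderiv_const_mul hw3]
    simp only [FunLike.coe_smul, Pi.smul_apply, smul_eq_mul, hw3', mul_zero]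
  -- rewrite the time partial inside the function as `Mt`
  have efun : (fun y : EuclideanSpace ℝ (Fin 3) =>
        2 * (1 - μ t (y 2)) * (timeDerivWithin (Iio 0) v t y + convect (v t) (v t) y - Δ (v t) y) 2
          - 2 * (deriv (fun s => μ s (y 2)) t - deriv (deriv (μ t)) (y 2)) * v t y 2
          - deriv (μ t) (y 2) * v t y 2 ^ 2
          + 4 * deriv (μ t) (y 2) * fderiv ℝ (v t) y (EuclideanSpace.single 2 1) 2) =
      fun y => 2 * (1 - μ t (y 2)) * (timeDerivWithin (Iio 0) v t y + convect (v t) (v t) y - Δ (v t) y) 2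
          - 2 * (Mt (y 2) - deriv (deriv (μ t)) (y 2)) * v t y 2
          - deriv (μ t) (y 2) * v t y 2 ^ 2
          + 4 * deriv (μ t) (y 2) * fderiv ℝ (v t) y (EuclideanSpace.single 2 1) 2 := by
    funext y; rw [hMt]
  rw [efun]
  -- ## differentiate term by term
  have hT : ∀ w, fderiv ℝ (fun y => v t y 2) x w = fderiv ℝ (v t) x w 2 := fun w =>
    FluidPDE.fderiv_apply_coord (hsd x) w 2
  have d1 : DifferentiableAt ℝ (fun y => 2 * (1 - μ t (y 2)) *
      (timeDerivWithin (Iio 0) v t y + convect (v t) (v t) y - Δ (v t) y) 2) x := hw1.mul hF2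
  have d2 : DifferentiableAt ℝ (fun y => 2 * (Mt (y 2) - deriv (deriv (μ t)) (y 2)) * v t y 2) x := hw2.mul hθd
  have hsq : DifferentiableAt ℝ (fun y => v t y 2 ^ 2) x := hθd.pow 2
  have d3 : DifferentiableAt ℝ (fun y => deriv (μ t) (y 2) * v t y 2 ^ 2) x := hw3.mul hsq
  have d4 : DifferentiableAt ℝ (fun y => 4 * deriv (μ t) (y 2) * fderiv ℝ (v t) y (EuclideanSpace.single 2 1) 2) x :=
    hw4.mul hE
  have d12 : DifferentiableAt ℝ (fun y => 2 * (1 - μ t (y 2)) *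
        (timeDerivWithin (Iio 0) v t y + convect (v t) (v t) y - Δ (v t) y) 2
      - 2 * (Mt (y 2) - deriv (deriv (μ t)) (y 2)) * v t y 2) x := d1.sub d2
  have d123 : DifferentiableAt ℝ (fun y => 2 * (1 - μ t (y 2)) *
        (timeDerivWithin (Iio 0) v t y + convect (v t) (v t) y - Δ (v t) y) 2
      - 2 * (Mt (y 2) - deriv (deriv (μ t)) (y 2)) * v t y 2
      - deriv (μ t) (y 2) * v t y 2 ^ 2) x := d12.sub d3
  rw [fderiv_fun_add d123 d4, fderiv_fun_sub d12 d3, fderiv_fun_sub d1 d2]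
  simp only [_root_.add_apply, _root_.sub_apply]
  have hsq' : fderiv ℝ (fun y => v t y 2 ^ 2) x (EuclideanSpace.single b 1) =
      2 * v t x 2 * fderiv ℝ (v t) x (EuclideanSpace.single b 1) 2 := by
    have e1 : (fun y => v t y 2 ^ 2) = fun y => v t y 2 * v t y 2 := funext fun y => sq _
    rw [e1, fderiv_fun_mul hθd hθd]
    simp only [_root_.add_apply, FunLike.coe_smul, Pi.smul_apply, smul_eq_mul, hT]
    ring
  rw [fderiv_fun_mul hw1 hF2, fderiv_fun_mul hw2 hθd, fderiv_fun_mul hw3 hsq, fderiv_fun_mul hw4 hE]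
  simp only [_root_.add_apply, FunLike.coe_smul, Pi.smul_apply, smul_eq_mul, hw1', hw2', hw3', hw4', hT, hsq']
  -- the mixed derivative `∂_b∂₂v₂ = ∂₂∂_b v₂`
  have hsym : fderiv ℝ (fun y => fderiv ℝ (v t) y (EuclideanSpace.single 2 1) 2) x (EuclideanSpace.single b 1) =
      fderiv ℝ (fun y => fderiv ℝ (v t) y (EuclideanSpace.single b 1) 2) x (EuclideanSpace.single 2 1) := by
    have e : ∀ c : EuclideanSpace ℝ (Fin 3), (fun y => fderiv ℝ (v t) y c 2) = fun y => fderiv ℝ (fun z => v t z 2) y c :=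
      fun c => funext fun y => (FluidPDE.fderiv_apply_coord (hsd y) c 2).symm
    rw [e, e]
    exact fderiv_fderiv_symm (hθ.of_le (by norm_cast)) x _ _
  rw [hsym, FluidPDE.fderiv_apply_coord hR]
  -- the pressure law closes it
  linear_combination 2 * hP

end Class

end Summit.NavierStokesRegularity.NavierStokesRegularity.Theorems.PoloidalWindowDoorPoloidalWindowRigidityTimeHeightShearWeight

end
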